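import Literature.AlgebraicGeometry.Motives.MonomialSupportedHypersurfaceSymmetry
import Literature.AlgebraicGeometry.Motives.UniversalHypersurfaceBaseChart
import Literature.AlgebraicGeometry.HodgeTheory.BettiUniverseIsoTransport
import Literature.AlgebraicGeometry.HodgeTheory.DirectImageEndomorphism
import Literature.AlgebraicGeometry.HodgeTheory.DirectImageBaseChangeContinuous
import Literature.AlgebraicGeometry.HodgeTheory.AlgebraicMonodromyMumfordTate
import Literature.AlgebraicGeometry.HodgeTheory.HypersurfaceComplexPoints
import HarnessLib

/-!
# Monodromy of the monomial-supported hypersurface family: equivariance under the diagonal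
# automorphism, base change to the universal family, points and coefficient chart

Family `hodge`, layer `Literature/AlgebraicGeometry/HodgeTheory`. Last part of the definition request
`defn-MonomialSupportedHypersurfaceFamily` (crux K1-B `stub_signPencilOrbitData` of route
SignSymmetricPowers; clauses (6) "equivariance of monodromy", addendum (7) "base change of transport to
the universal family", addendum (9) "coefficient chart of `baseM` compatible with `coeffVector`").

Notation as in `Motives/MonomialSupportedHypersurfaceFamily` and `…Symmetry`: `π : 𝒴_U → U` the universal
family of smooth degree-`d` hypersurfaces in `ℙⁿ⁺¹` (`family`), `g_M : S_M → U` the nonsingular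
`M`-supported forms (`toBase`), `π_M : 𝒴_M = 𝒴_U ×_U S_M → S_M` (`familyM`), `σ_γ : 𝒴_M → 𝒴_M` the relative
diagonal automorphism for `γ` fixing the monomials of `M` (`sigmaM`) with fibre maps `σ_{γ,t}`
(`sigmaMFiber`), `e_t : 𝒴_{M,t} ≅ 𝒴_{g_M t}` the fibre isomorphism of the base change (`fiberIsoM`, the
tree's `Motives.fiberOverFamilyPullbackIso` typed over `familyM`).

## What is proved

* Points (any field `k`): `pointOfForm_pointForm` (every `s ∈ U(k)` is `[F_s]`), `range_map_toBase`
  (`g_M(S_M(k)) = {s ∈ U(k) | F_s supported on M}`), `fiberIsoM_hom_fiberι` /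
  `fiberIsoM_hom_toProjectiveSpace`; with the strong topology (`k : Type`): `isEmbedding_map_toBase`
  (`S_M(L) ↪ U(L)` is an embedding — a closed immersion on points, Serre GAGA §2 n°5) and
  `exists_path_lift_toBase` (**paths of `M`-supported forms in `U(k)` lift to `S_M(k)`**).
* Chart (addendum (9)): `coeffVector_map_toBase_of_not_mem` / `_of_mem` (the coefficient vector of
  `g_M(t)` — file `Motives/UniversalHypersurfaceBaseChart` — vanishes off `M` and is `(t(a_m))_{m ∈ M}` on
  `M`), `injective_coeffVector_map_toBase_restrict`, `range_coeffVector_map_toBase_restrict` (image = the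
  `a ∈ k^M` whose extension by zero is a nonsingular form).
* Equivariance (clause (6)): `pullEquiv_pull_sigmaMFiber` (**under a compatible fibre isomorphism
  `σ_{γ,t}^*` is conjugate to `diagonalAut^*`**), `transportFun_map_sigmaMFiber` (transport commutes with
  `σ_γ^*`, from `DirectImageEndomorphism.transportFun_map_fiberHom`), `isRatTransport_map_pull_sigmaMFiber`
  and **H1** `ratMonodromyGroup_map_pull_sigmaMFiber`: every `g ∈ Γ_{M,s}` commutes with `σ_{γ,s}^*` on
  `Hᵏ(𝒴_{M,s}(ℂ); ℚ)`.
* Base change (addendum (7)): `map_inv_transportFun_familyM` (**`(e_{t'}⁻¹)^* γ'_* = γ_* (e_{s'}⁻¹)^*`**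
  for a path `γ'` in `S_M(ℂ)` over `γ` in `U(ℂ)`, from
  `FiberClass.baseChange_transportFun_of_isCohomologicallyLocallyTrivialOn`), `isRatTransport_familyM_iff`
  (rational transports correspond under conjugation by `pullEquiv e`), `isRatTransport_familyM_of_family`
  (consume a rational transport of the universal family — e.g. a Picard–Lefschetz transformation of
  `HodgeTheory/PicardLefschetzNodalForms` — on `𝒴_M`), `conj_mem_ratMonodromyGroup_family` (**the
  monodromy group can only shrink under base change**) and `conj_mem_ratMonodromyGroup_familyM` (a
  monodromy transformation along a loop lifting to `S_M(ℂ)` restricts to `Γ_{M,t}`).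

That transports are `tr ∘ cup`-isometries is the tree's `transportFun_cupProduct` /
`IsFlatCoefficient.tr_cup_eq_of_mem_ratMonodromyGroup` (universal family) moved along these lemmas; it is
not restated here.

## References

* C. Voisin, *Hodge Theory and Complex Algebraic Geometry II* (2003), §3.1.1–§3.1.2 (local systems
  `Rᵏ π_* A`, functoriality, inverse image, monodromy representation), §6.2.1 (the universal family).
  [VoisinHodgeII2003]
* J. Carlson, S. Müller-Stach, C. Peters, *Period Mappings and Period Domains*, 2nd ed. (2017),
  Lemma–Definition 15.3.7 (the monodromy group). [CarlsonMullerStachPeters2017]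
* N. M. Katz, *Another look at the Dwork family* (2009), §3 (a diagonal group acting on a family over
  its base and on the cohomology of the fibres). [Katz2009]
* J.-P. Serre, *Géométrie algébrique et géométrie analytique* (1956), §2 n°5 (closed subvarieties and
  the strong topology). [SerreGAGA1956]
* R. Hartshorne, *Algebraic Geometry* (1977), II Thm 3.3 (fibre products and fibres). [Hartshorne1977]
-/

noncomputable section

open CategoryTheory AlgebraicGeometry MvPolynomial Topology
open Literature.AlgebraicTopology.SingularHomology
open Literature.AlgebraicGeometry.Motives
open Literature.AlgebraicGeometry.Motives.UniversalHypersurface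

universe u

namespace Literature.AlgebraicGeometry.HodgeTheory.UniversalHypersurface

/-! ### The points of `S_M` inside `U`: image, fibres, embedding, lifting of paths -/

section Points

variable (k : Type u) [Field k] (n d : ℕ) (M : Set (DegIndex n d))

/-- The coefficient homomorphism of the point `[F_s]` of the form of `s ∈ U(k)` is that of `s`.
[cite: VoisinHodgeII2003, §6.2.1] -/
theorem coeffHom_pointForm (s : AlgPoints (base k n d) k) :
    CommRingCat.ofHom (coeffHom k n d (pointForm k n d s)).toRingHom = pointHom k n d s := by
  ext1
  rw [CommRingCat.hom_ofHom]
  refine MvPolynomial.ringHom_ext (fun r => ?_) fun m => ?_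
  · have hs := congrArg (fun φ : k →+* k => φ r) (pointHom_comp_algebraMap k n d s)
    simp only [RingHom.comp_apply] at hs
    rw [MvPolynomial.algebraMap_eq] at hs
    rw [hs, AlgHom.toRingHom_eq_coe, AlgHom.coe_toRingHom, ← MvPolynomial.algebraMap_eq, AlgHom.commutes]
  · rw [AlgHom.toRingHom_eq_coe, AlgHom.coe_toRingHom, MvPolynomial.aeval_X]
    exact coeff_pointForm k n d s m

/-- **Every `k`-point of `U` is the point `[F_s]` of its form.** [cite: VoisinHodgeII2003, §6.2.1] -/
theorem pointOfForm_pointForm (s : AlgPoints (base k n d) k) :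
    pointOfForm k n d (isHomogeneous_pointForm k n d s) (isNonsingularForm_pointForm k n d s) = s := by
  apply pointHom_injective k n d
  rw [pointHom_pointOfForm, coeffHom_pointForm]

/-- **The `k`-points of `S_M` are exactly the points of `U` whose form is supported on `M`** (image of
`S_M(k) ↪ U(k)`). [cite: VoisinHodgeII2003, §6.2.1] -/
theorem range_map_toBase :
    Set.range (AlgPoints.map (toBase k n d M) : AlgPoints (baseM k n d M) k → AlgPoints (base k n d) k) =
      {s | IsSupportedOn n d M (pointForm k n d s)} := by
  ext s
  constructor
  · rintro ⟨t, rfl⟩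
    exact isSupportedOn_pointFormM k n d M t
  · intro hs
    exact ⟨pointOfFormM k n d M (isHomogeneous_pointForm k n d s) (isNonsingularForm_pointForm k n d s) hs, by
      rw [map_toBase_pointOfFormM, pointOfForm_pointForm]⟩

/-- A point of `U(k)` with `M`-supported form is the image of the point of `S_M(k)` of its form.
[cite: VoisinHodgeII2003, §6.2.1] -/
theorem map_toBase_pointOfFormM_pointForm (s : AlgPoints (base k n d) k)
    (hs : IsSupportedOn n d M (pointForm k n d s)) :
    AlgPoints.map (toBase k n d M)
        (pointOfFormM k n d M (isHomogeneous_pointForm k n d s) (isNonsingularForm_pointForm k n d s) hs) = s := by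
  rw [map_toBase_pointOfFormM, pointOfForm_pointForm]

/-- **The fibre of the `M`-supported family over `t` is the fibre of the universal family over `g_M(t)`**:
the isomorphism `e_t : 𝒴_{M,t} ≅ 𝒴_{g_M t}` of the base change (the tree's
`Motives.fiberOverFamilyPullbackIso`, given here its type over `familyM` so that statements about
`familyM` rewrite smoothly). [cite: Hartshorne1977, II Thm 3.3] -/
def fiberIsoM (t : AlgPoints (baseM k n d M) k) :
    fiberOver (familyM k n d M) t ≅ fiberOver (family k n d) (AlgPoints.map (toBase k n d M) t) :=
  fiberOverFamilyPullbackIso (family k n d) (toBase k n d M) t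

/-- `fiberIsoM` is the base-change fibre isomorphism (`rfl`). [cite: Hartshorne1977, II Thm 3.3] -/
theorem fiberIsoM_eq (t : AlgPoints (baseM k n d M) k) :
    fiberIsoM k n d M t = fiberOverFamilyPullbackIso (family k n d) (toBase k n d M) t :=
  rfl

/-- `e_t` is compatible with the inclusions of the fibres: `e_t ≫ ι_{g t} = ι_t ≫ (𝒴_M → 𝒴_U)`.
[cite: Hartshorne1977, II Thm 3.3] -/
@[reassoc]
theorem fiberIsoM_hom_fiberι (t : AlgPoints (baseM k n d M) k) :
    (fiberIsoM k n d M t).hom ≫ fiberι (family k n d) (AlgPoints.map (toBase k n d M) t) =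
      fiberι (familyM k n d M) t ≫ totalMToTotal k n d M :=
  fiberOverFamilyPullbackIso_hom_fiberι (family k n d) (toBase k n d M) t

/-- Hence `e_t` is compatible with the projections to `ℙⁿ⁺¹_k`:
`e_t ≫ (𝒴_{g t} → ℙⁿ⁺¹) = (𝒴_{M,t} → ℙⁿ⁺¹)`. [cite: VoisinHodgeII2003, §6.2.1] -/
theorem fiberIsoM_hom_toProjectiveSpace (t : AlgPoints (baseM k n d M) k) :
    (fiberIsoM k n d M t).hom ≫ fiberι (family k n d) (AlgPoints.map (toBase k n d M) t) ≫
        UniversalHypersurface.toProjectiveSpace k n d = fiberToProjectiveSpace k n d M t := by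
  rw [fiberIsoM_hom_fiberι_assoc]

end Points

section PointsTopology

variable (k : Type) [Field k] (n d : ℕ) (M : Set (DegIndex n d)) {L : Type} [Field L] [Algebra k L]
  [TopologicalSpace L]

/-- **`S_M(L) ↪ U(L)` is a topological embedding** for the strong topologies (`S_M → U` is a closed
immersion, `Motives.AlgPoints.isEmbedding_map_of_isClosedImmersion`). [cite: SerreGAGA1956, §2 n°5] -/
theorem isEmbedding_map_toBase :
    IsEmbedding (AlgPoints.map (toBase k n d M) : AlgPoints (baseM k n d M) L → AlgPoints (base k n d) L) := by
  haveI := isClosedImmersion_toBase_left k n d M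
  exact AlgPoints.isEmbedding_map_of_isClosedImmersion (toBase k n d M)

/-- **Lifting paths of `M`-supported forms to `S_M`**: a path in `U(L)` all of whose forms are supported on
`M`, between images of points `t₁, t₂ ∈ S_M(L)` (`L = k` here), lifts to a path from `t₁` to `t₂` in `S_M(L)`
(the map on points is an embedding with image the `M`-supported forms). [cite: SerreGAGA1956, §2 n°5] -/
theorem exists_path_lift_toBase [TopologicalSpace k] {t₁ t₂ : AlgPoints (baseM k n d M) k}
    (γ : Path (AlgPoints.map (toBase k n d M) t₁) (AlgPoints.map (toBase k n d M) t₂))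
    (hγ : ∀ u, IsSupportedOn n d M (pointForm k n d (γ u))) :
    ∃ γ' : Path t₁ t₂, ∀ u, AlgPoints.map (toBase k n d M) (γ' u) = γ u := by
  have hE := isEmbedding_map_toBase k n d M (L := k)
  have hmem : ∀ u, γ u ∈ Set.range (AlgPoints.map (toBase k n d M) : AlgPoints (baseM k n d M) k → _) :=
    fun u => by rw [range_map_toBase]; exact hγ u
  have he : ∀ t, (hE.toHomeomorph t).1 = AlgPoints.map (toBase k n d M) t := fun t =>
    Topology.IsEmbedding.toHomeomorph_apply_coe hE t
  have hinv : ∀ (t : AlgPoints (baseM k n d M) k) (h),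
      hE.toHomeomorph.symm ⟨AlgPoints.map (toBase k n d M) t, h⟩ = t := fun t h => by
    rw [Homeomorph.symm_apply_eq]
    exact Subtype.ext (he t).symm
  refine ⟨⟨⟨fun u => hE.toHomeomorph.symm ⟨γ u, hmem u⟩,
    hE.toHomeomorph.symm.continuous.comp (γ.continuous.subtype_mk _)⟩,
    by simp only [Path.source, hinv], by simp only [Path.target, hinv]⟩,
    fun u => ?_⟩
  have h1 := he (hE.toHomeomorph.symm ⟨γ u, hmem u⟩)
  rw [Homeomorph.apply_symm_apply] at h1
  exact h1.symm

end PointsTopology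

/-! ### The coefficient chart of `S_M` along `S_M → U` -/

section Chart

variable (k : Type) [Field k] (n d : ℕ) (M : Set (DegIndex n d)) {L : Type} [Field L] [Algebra k L]

/-- **Compatibility of the coefficient chart with `g_M : S_M → U`**, coordinates outside `M`: the
coefficient vector (`coeffVector`, file `Motives/UniversalHypersurfaceBaseChart`) of the image of a point of
`S_M` vanishes at every `m ∉ M`. [cite: VoisinHodgeII2003, §6.2.1] -/
theorem coeffVector_map_toBase_of_not_mem (t : AlgPoints (baseM k n d M) L) {m : DegIndex n d} (hm : m ∉ M) :
    coeffVector k n d (AlgPoints.map (toBase k n d M) t) m = 0 := by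
  rw [coeffVector_apply]
  exact isSupportedOn_pointFormM k n d M t m hm

/-- **Compatibility of the coefficient chart with `g_M : S_M → U`**, coordinates in `M`: the `m`-th
coefficient of the image of `t ∈ S_M(L)` is the value `t(a_m)` of the coefficient homomorphism of `t` on the
variable `a_m` of `R_M = k[a_m | m ∈ M]`. [cite: VoisinHodgeII2003, §6.2.1] -/
theorem coeffVector_map_toBase_of_mem (t : AlgPoints (baseM k n d M) L) {m : DegIndex n d} (hm : m ∈ M) :
    coeffVector k n d (AlgPoints.map (toBase k n d M) t) m = (pointHomM k n d M t).hom (X ⟨m, hm⟩) := by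
  rw [coeffVector_apply]
  exact coeff_pointFormM_of_mem k n d M t hm

/-- **The coefficient chart of `S_M`**, `t ↦ (t(a_m))_{m ∈ M} = coeffVector (g_M t) ∘ (M ⊆ DegIndex)`, is
injective. [cite: VoisinHodgeII2003, §6.2.1] -/
theorem injective_coeffVector_map_toBase_restrict :
    Function.Injective fun t : AlgPoints (baseM k n d M) L =>
      (coeffVector k n d (AlgPoints.map (toBase k n d M) t)) ∘ (Subtype.val : M → DegIndex n d) := by
  intro t t' h
  apply map_toBase_injective k n d M
  apply coeffVector_injective k n d
  funext m
  by_cases hm : m ∈ M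
  · exact congrFun h ⟨m, hm⟩
  · rw [coeffVector_map_toBase_of_not_mem k n d M t hm, coeffVector_map_toBase_of_not_mem k n d M t' hm]

/-- **The image of the coefficient chart of `S_M` on `k`-points**: the vectors `a ∈ k^M` whose extension
by zero `Σ_{m ∈ M} a_m x^m` is a nonsingular form. [cite: VoisinHodgeII2003, §6.2.1] -/
theorem range_coeffVector_map_toBase_restrict [DecidablePred (· ∈ M)] :
    Set.range (fun t : AlgPoints (baseM k n d M) k =>
        (coeffVector k n d (AlgPoints.map (toBase k n d M) t)) ∘ (Subtype.val : M → DegIndex n d)) =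
      {a : M → k | SmoothHypersurface.IsNonsingularForm k
        (formOfCoeffs fun m : DegIndex n d => if h : m ∈ M then a ⟨m, h⟩ else 0)} := by
  ext a
  constructor
  · rintro ⟨t, rfl⟩
    have hext : (fun m : DegIndex n d => if h : m ∈ M then
        ((coeffVector k n d (AlgPoints.map (toBase k n d M) t)) ∘ (Subtype.val : M → DegIndex n d)) ⟨m, h⟩
        else 0) = coeffVector k n d (AlgPoints.map (toBase k n d M) t) := by
      funext m
      by_cases hm : m ∈ M
      · rw [dif_pos hm]
        rfl
      · rw [dif_neg hm, coeffVector_map_toBase_of_not_mem k n d M t hm]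
    show SmoothHypersurface.IsNonsingularForm k _
    rw [hext, formOfCoeffs_coeffVector]
    exact isNonsingularForm_pointForm k n d _
  · intro ha
    have hAM : IsSupportedOn n d M (formOfCoeffs fun m : DegIndex n d => if h : m ∈ M then a ⟨m, h⟩ else 0) :=
      fun m hm => by
        rw [coeff_formOfCoeffs]
        exact dif_neg hm
    refine ⟨pointOfFormM k n d M (isHomogeneous_formOfCoeffs _) ha hAM, funext fun m => ?_⟩
    show coeffVector k n d (AlgPoints.map (toBase k n d M) _) m.1 = a m
    rw [map_toBase_pointOfFormM, coeffVector_apply, pointForm_pointOfForm, coeff_formOfCoeffs, dif_pos m.2]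

end Chart

/-! ### `σ_{γ,t}^*` on the cohomology of the fibres and its conjugation to `diagonalAut^*` -/

section Sigma

variable (n d : ℕ) (M : Set (DegIndex n d)) (γ : Fin (n + 2) → ℂˣ)

/-- **On cohomology**: with `φ = (e⁻¹)^* : Hⁱ(𝒴_{M,t}) ≃ Hⁱ(X_G)` the identification of the fibre with the
model hypersurface along a fibre isomorphism compatible with the embeddings into `ℙⁿ⁺¹`,
`φ (σ_{γ,t}^* x) = (diagonalAut G)^* (φ x)`. [cite: Katz2009, §3] -/
theorem pullEquiv_pull_sigmaMFiber (hγ : FixesMonomials ℂ n d M γ) (t : AlgPoints (baseM ℂ n d M) ℂ)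
    {G : MvPolynomial (Fin (n + 2)) ℂ} (e : fiberOver (familyM ℂ n d M) t ≅ SmoothHypersurface.hypersurface G)
    (he : e.hom ≫ SmoothHypersurface.hypersurfaceι G = fiberToProjectiveSpace ℂ n d M t)
    (ha : γ ∈ HodgeTheory.diagonalStabilizer G) (i : ℕ)
    (x : bettiCohomology (fiberOver (familyM ℂ n d M) t) i) :
    BettiUniverse.pullEquiv e i (BettiUniverse.pull (sigmaMFiber ℂ n d M γ hγ t) i x) =
      BettiUniverse.pull (HodgeTheory.diagonalAut G ha) i (BettiUniverse.pullEquiv e i x) := by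
  have hconj : e.inv ≫ sigmaMFiber ℂ n d M γ hγ t = HodgeTheory.diagonalAut G ha ≫ e.inv := by
    rw [Iso.inv_comp_eq, ← Category.assoc, Iso.eq_comp_inv]
    exact sigmaMFiber_comp_eq_diagonalAut n d M γ hγ t e he ha
  rw [BettiUniverse.pullEquiv_apply, BettiUniverse.pullEquiv_apply, ← LinearMap.comp_apply,
    ← BettiUniverse.pull_comp, hconj, BettiUniverse.pull_comp, LinearMap.comp_apply]

/-- **`σ_{γ,t}^*` is an involution when `γ² = 1`** (e.g. `γ = diag(-1,-1,1,…,1)`; `d ≥ 1`): on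
`Hⁱ(𝒴_{M,t}(ℂ); ℚ)`, `σ_{γ,t}^* ∘ σ_{γ,t}^* = id` — conjugate `σ_{γ,t}^*` to `diagonalAut^*` along a compatible
fibre isomorphism and use `g_γ ∘ g_γ = g_{γ²} = id` on complex points (`diagonalMap_mul`, `diagonalMap_one`).
[cite: Katz2009, §3] -/
theorem pull_sigmaMFiber_pull_sigmaMFiber (hd : 0 < d) (hγ : FixesMonomials ℂ n d M γ) (hγ2 : γ * γ = 1)
    (t : AlgPoints (baseM ℂ n d M) ℂ) (i : ℕ) (x : bettiCohomology (fiberOver (familyM ℂ n d M) t) i) :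
    BettiUniverse.pull (sigmaMFiber ℂ n d M γ hγ t) i (BettiUniverse.pull (sigmaMFiber ℂ n d M γ hγ t) i x) = x := by
  obtain ⟨e, he⟩ := exists_fiberIsoM_comp_hypersurfaceι ℂ n d M hd t
  have ha : γ ∈ HodgeTheory.diagonalStabilizer (pointFormM ℂ n d M t) :=
    mem_diagonalStabilizer_of_isSupportedOn hγ (isHomogeneous_pointForm ℂ n d _) (isSupportedOn_pointFormM ℂ n d M t)
  have hmap : AlgPoints.mapContinuous (L := ℂ)
      (HodgeTheory.diagonalAut _ ha ≫ HodgeTheory.diagonalAut _ ha) =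
        AlgPoints.mapContinuous (L := ℂ) (𝟙 (SmoothHypersurface.hypersurface (pointFormM ℂ n d M t))) := by
    rw [AlgPoints.mapContinuous_comp, AlgPoints.mapContinuous_id]
    change (HodgeTheory.diagonalMap _ ha).comp (HodgeTheory.diagonalMap _ ha) = _
    rw [← HodgeTheory.diagonalMap_mul ha ha, ← HodgeTheory.diagonalMap_one (F := pointFormM ℂ n d M t)]
    congr 1
  have hsq : BettiUniverse.pull (HodgeTheory.diagonalAut _ ha ≫ HodgeTheory.diagonalAut _ ha) i = LinearMap.id := by
    rw [← BettiUniverse.pull_id (SmoothHypersurface.hypersurface (pointFormM ℂ n d M t)) i, BettiUniverse.pull,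
      BettiUniverse.pull, bettiCohomology.map, bettiCohomology.map, hmap]
  apply (BettiUniverse.pullEquiv e i).injective
  rw [pullEquiv_pull_sigmaMFiber n d M γ hγ t e he ha, pullEquiv_pull_sigmaMFiber n d M γ hγ t e he ha,
    ← LinearMap.comp_apply, ← BettiUniverse.pull_comp, hsq, LinearMap.id_apply]

variable (k : ℕ) {U : Set (ComplexPoints (baseM ℂ n d M))}
  (hU : IsCohomologicallyLocallyTrivialOn (familyM ℂ n d M) U)

/-- **Transport commutes with `σ_γ^*`** (complex coefficients): for a homotopy class of paths `δ` from
`s` to `t` in a cohomologically locally trivial `U ⊆ S_M(ℂ)`, `δ_* (σ_{γ,s}^* α) = σ_{γ,t}^* (δ_* α)` —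
`σ_γ` is an endomorphism of the family over the base (`DirectImageEndomorphism.transportFun_map_fiberHom`).
[cite: VoisinHodgeII2003, §3.1.2] -/
theorem transportFun_map_sigmaMFiber (hγ : FixesMonomials ℂ n d M γ) {s t : U}
    (δ : Path.Homotopic.Quotient s t) (α : complexBetti (fiberOver (familyM ℂ n d M) s.1) k) :
    transportFun (familyM ℂ n d M) k hU δ (complexBetti.map (sigmaMFiber ℂ n d M γ hγ s.1) k α) =
      complexBetti.map (sigmaMFiber ℂ n d M γ hγ t.1) k (transportFun (familyM ℂ n d M) k hU δ α) :=
  transportFun_map_fiberHom (familyM ℂ n d M) k hU (sigmaM ℂ n d M γ hγ) (sigmaM_comp_familyM ℂ n d M γ hγ)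
    (fun t => sigmaMFiber ℂ n d M γ hγ t) (fun t => sigmaMFiber_comp_fiberι ℂ n d M γ hγ t) δ α

/-- **Rational transports commute with `σ_γ^*`**: if `T : Hᵏ(𝒴_{M,s}; ℚ) ≃ Hᵏ(𝒴_{M,t}; ℚ)` is the rational
transport along `δ`, then `T (σ_{γ,s}^* v) = σ_{γ,t}^* (T v)` (`ofRatClass` is injective and natural).
[cite: VoisinHodgeII2003, §3.1.2] -/
theorem isRatTransport_map_pull_sigmaMFiber (hγ : FixesMonomials ℂ n d M γ) {s t : U}
    {δ : Path.Homotopic.Quotient s t}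
    {T : bettiCohomology (fiberOver (familyM ℂ n d M) s.1) k ≃ₗ[ℚ]
      bettiCohomology (fiberOver (familyM ℂ n d M) t.1) k}
    (hT : IsRatTransport (familyM ℂ n d M) k hU δ T) (v : bettiCohomology (fiberOver (familyM ℂ n d M) s.1) k) :
    T (BettiUniverse.pull (sigmaMFiber ℂ n d M γ hγ s.1) k v) =
      BettiUniverse.pull (sigmaMFiber ℂ n d M γ hγ t.1) k (T v) := by
  apply ofRatClass_injective
  rw [hT, BettiUniverse.pull, BettiUniverse.pull]
  change transportFun (familyM ℂ n d M) k hU δ (ofRatClass _ k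
      (singularCohomology.map ℚ ℚ (AlgPoints.mapContinuous (L := ℂ) (sigmaMFiber ℂ n d M γ hγ s.1)) k v)) =
    ofRatClass _ k (singularCohomology.map ℚ ℚ
      (AlgPoints.mapContinuous (L := ℂ) (sigmaMFiber ℂ n d M γ hγ t.1)) k (T v))
  rw [ofRatClass_map, ofRatClass_map, hT]
  exact transportFun_map_sigmaMFiber n d M γ k hU hγ δ (ofRatClass _ k v)

/-- **H1 — the monodromy group commutes with `σ_γ^*`**: every `g ∈ Γ_s` (rational transports of loops at
`s` in `U`, `ratMonodromyGroup`) satisfies `g ∘ σ_{γ,s}^* = σ_{γ,s}^* ∘ g`.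
[cite: CarlsonMullerStachPeters2017, Lemma–Definition 15.3.7] -/
theorem ratMonodromyGroup_map_pull_sigmaMFiber (hγ : FixesMonomials ℂ n d M γ) (s : U)
    {g : bettiCohomology (fiberOver (familyM ℂ n d M) s.1) k ≃ₗ[ℚ]
      bettiCohomology (fiberOver (familyM ℂ n d M) s.1) k}
    (hg : g ∈ ratMonodromyGroup (familyM ℂ n d M) k hU s)
    (x : bettiCohomology (fiberOver (familyM ℂ n d M) s.1) k) :
    g (BettiUniverse.pull (sigmaMFiber ℂ n d M γ hγ s.1) k x) =
      BettiUniverse.pull (sigmaMFiber ℂ n d M γ hγ s.1) k (g x) := by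
  obtain ⟨δ, hδ⟩ := hg
  exact isRatTransport_map_pull_sigmaMFiber n d M γ k hU hγ hδ x

end Sigma

/-! ### Base change of transport from the `M`-supported family to the universal family -/

section BaseChange

variable (n d : ℕ) (M : Set (DegIndex n d)) (k : ℕ)

/-- `S_M(ℂ) → U(ℂ)` (on the subtypes `Set.univ`) is continuous (`g_M` is algebraic, hence continuous for the
strong topology). [cite: SerreGAGA1956, §2 n°5] -/
theorem continuous_mapToBaseUniv :
    Continuous fun x : (Set.univ : Set (ComplexPoints (baseM ℂ n d M))) =>
      (⟨AlgPoints.map (toBase ℂ n d M) x.1, Set.mem_univ _⟩ : (Set.univ : Set (ComplexPoints (base ℂ n d)))) :=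
  ((AlgPoints.continuous_map (L := ℂ) (toBase ℂ n d M)).comp continuous_subtype_val).subtype_mk _

/-- **Transport commutes with the base change `𝒴_M = 𝒴_U ×_U S_M → 𝒴_U`** (complex coefficients): for a
path `γ'` in `S_M(ℂ)` over the path `γ` in `U(ℂ)` and the fibre isomorphisms `e_t : 𝒴_{M,t} ≅ 𝒴_{g t}`
(`fiberIsoM`), `(e_{t'}⁻¹)^* (γ'_* α') = γ_* ((e_{s'}⁻¹)^* α')` — the local system `Rᵏ π_{M*} ℂ` is the
inverse image `g_M⁻¹ Rᵏ π_* ℂ` (`FiberClass.baseChange_transportFun_of_isCohomologicallyLocallyTrivialOn`,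
valid for every morphism of bases). [cite: VoisinHodgeII2003, §3.1.2] -/
theorem map_inv_transportFun_familyM
    (hU : IsCohomologicallyLocallyTrivialOn (family ℂ n d) Set.univ)
    (hU' : IsCohomologicallyLocallyTrivialOn (familyM ℂ n d M) Set.univ)
    {s' t' : (Set.univ : Set (ComplexPoints (baseM ℂ n d M)))} (γ' : Path s' t')
    (γ : Path (⟨AlgPoints.map (toBase ℂ n d M) s'.1, Set.mem_univ _⟩ :
        (Set.univ : Set (ComplexPoints (base ℂ n d))))
      ⟨AlgPoints.map (toBase ℂ n d M) t'.1, Set.mem_univ _⟩)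
    (hγ : ∀ u, AlgPoints.map (toBase ℂ n d M) (γ' u).1 = (γ u).1)
    (α' : complexBetti (fiberOver (familyM ℂ n d M) s'.1) k) :
    complexBetti.map (fiberIsoM ℂ n d M t'.1).inv k (transportFun (familyM ℂ n d M) k hU' ⟦γ'⟧ α') =
      transportFun (family ℂ n d) k hU ⟦γ⟧ (complexBetti.map (fiberIsoM ℂ n d M s'.1).inv k α') := by
  have h := FiberClass.baseChange_transportFun_of_isCohomologicallyLocallyTrivialOn (family ℂ n d)
    (toBase ℂ n d M) hU hU' k γ γ' hγ α' (α := complexBetti.map (fiberIsoM ℂ n d M s'.1).inv k α') rfl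
  exact ((FiberClass.mk_eq_mk_iff _ _).1 h).symm

/-- **Rational transports under the base change**: `T'` is the rational transport along `γ'` in the
`M`-supported family iff its conjugate `(e_{t'}⁻¹)^* ∘ T' ∘ e_{s'}^*` by the fibre isomorphisms is the
rational transport along the image path `γ` in the universal family. [cite: VoisinHodgeII2003, §3.1.2] -/
theorem isRatTransport_familyM_iff
    (hU : IsCohomologicallyLocallyTrivialOn (family ℂ n d) Set.univ)
    (hU' : IsCohomologicallyLocallyTrivialOn (familyM ℂ n d M) Set.univ)
    {s' t' : (Set.univ : Set (ComplexPoints (baseM ℂ n d M)))} (γ' : Path s' t')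
    (γ : Path (⟨AlgPoints.map (toBase ℂ n d M) s'.1, Set.mem_univ _⟩ :
        (Set.univ : Set (ComplexPoints (base ℂ n d))))
      ⟨AlgPoints.map (toBase ℂ n d M) t'.1, Set.mem_univ _⟩)
    (hγ : ∀ u, AlgPoints.map (toBase ℂ n d M) (γ' u).1 = (γ u).1)
    (T' : bettiCohomology (fiberOver (familyM ℂ n d M) s'.1) k ≃ₗ[ℚ]
      bettiCohomology (fiberOver (familyM ℂ n d M) t'.1) k) :
    IsRatTransport (familyM ℂ n d M) k hU' ⟦γ'⟧ T' ↔
      IsRatTransport (family ℂ n d) k hU ⟦γ⟧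
        ((BettiUniverse.pullEquiv (fiberIsoM ℂ n d M s'.1) k).symm ≪≫ₗ T' ≪≫ₗ
          BettiUniverse.pullEquiv (fiberIsoM ℂ n d M t'.1) k) := by
  have hQ : ∀ v' : bettiCohomology (fiberOver (familyM ℂ n d M) s'.1) k,
      BettiUniverse.pull (fiberIsoM ℂ n d M s'.1).hom k (BettiUniverse.pull (fiberIsoM ℂ n d M s'.1).inv k v') =
        v' := fun v' => by
    rw [← LinearMap.comp_apply, ← BettiUniverse.pull_comp, Iso.hom_inv_id, BettiUniverse.pull_id]
    rfl
  have hQ' : ∀ v : bettiCohomology (fiberOver (family ℂ n d) (AlgPoints.map (toBase ℂ n d M) s'.1)) k,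
      BettiUniverse.pull (fiberIsoM ℂ n d M s'.1).inv k (BettiUniverse.pull (fiberIsoM ℂ n d M s'.1).hom k v) =
        v := fun v => by
    rw [← LinearMap.comp_apply, ← BettiUniverse.pull_comp, Iso.inv_hom_id, BettiUniverse.pull_id]
    rfl
  -- `ofRat ∘ pull e = map e ∘ ofRat` (naturality of the rational lattice)
  have hnat : ∀ {X Y : SchemeOver ℂ} (f : X ⟶ Y) (v : bettiCohomology Y k),
      ofRatClass _ k (BettiUniverse.pull f k v) = complexBetti.map f k (ofRatClass _ k v) := fun f v =>
    ofRatClass_map k (AlgPoints.mapContinuous (L := ℂ) f) v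
  have key : ∀ v' : bettiCohomology (fiberOver (familyM ℂ n d M) s'.1) k,
      ofRatClass _ k (((BettiUniverse.pullEquiv (fiberIsoM ℂ n d M s'.1) k).symm ≪≫ₗ T' ≪≫ₗ
          BettiUniverse.pullEquiv (fiberIsoM ℂ n d M t'.1) k)
          (BettiUniverse.pull (fiberIsoM ℂ n d M s'.1).inv k v')) =
        complexBetti.map (fiberIsoM ℂ n d M t'.1).inv k (ofRatClass _ k (T' v')) := fun v' => by
    rw [LinearEquiv.trans_apply, LinearEquiv.trans_apply, BettiUniverse.pullEquiv_symm_apply,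
      BettiUniverse.pullEquiv_apply, hQ, hnat]
  constructor
  · intro hT' v
    conv_lhs => rw [← hQ' v]
    rw [key, hT', map_inv_transportFun_familyM n d M k hU hU' γ' γ hγ, hnat,
      (fiberIsoM ℂ n d M s'.1).complexBetti_map_inv_map_hom]
  · intro hT v'
    have hinj : Function.Injective (complexBetti.map (fiberIsoM ℂ n d M t'.1).inv k) :=
      complexBetti_map_fiberOverFamilyPullbackIso_inv_injective (family ℂ n d) (toBase ℂ n d M) t'.1 k
    apply hinj
    rw [map_inv_transportFun_familyM n d M k hU hU' γ' γ hγ, ← key, hT, hnat]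

/-- **Consuming a rational transport of the universal family on the `M`-supported family**: if `T` is the
rational transport along the image path `γ` in `U(ℂ)`, then `e_{s'}^{-1*}⁻¹ …` precisely
`pullEquiv e_{s'} ≪≫ T ≪≫ (pullEquiv e_{t'})⁻¹ = (v' ↦ e_{t'}^* (T ((e_{s'}⁻¹)^* v')))` is the rational
transport along `γ'` in `S_M(ℂ)`. [cite: VoisinHodgeII2003, §3.1.2] -/
theorem isRatTransport_familyM_of_family
    (hU : IsCohomologicallyLocallyTrivialOn (family ℂ n d) Set.univ)
    (hU' : IsCohomologicallyLocallyTrivialOn (familyM ℂ n d M) Set.univ)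
    {s' t' : (Set.univ : Set (ComplexPoints (baseM ℂ n d M)))} (γ' : Path s' t')
    (γ : Path (⟨AlgPoints.map (toBase ℂ n d M) s'.1, Set.mem_univ _⟩ :
        (Set.univ : Set (ComplexPoints (base ℂ n d))))
      ⟨AlgPoints.map (toBase ℂ n d M) t'.1, Set.mem_univ _⟩)
    (hγ : ∀ u, AlgPoints.map (toBase ℂ n d M) (γ' u).1 = (γ u).1)
    {T : bettiCohomology (fiberOver (family ℂ n d) (AlgPoints.map (toBase ℂ n d M) s'.1)) k ≃ₗ[ℚ]
      bettiCohomology (fiberOver (family ℂ n d) (AlgPoints.map (toBase ℂ n d M) t'.1)) k}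
    (hT : IsRatTransport (family ℂ n d) k hU ⟦γ⟧ T) :
    IsRatTransport (familyM ℂ n d M) k hU' ⟦γ'⟧
      (BettiUniverse.pullEquiv (fiberIsoM ℂ n d M s'.1) k ≪≫ₗ T ≪≫ₗ
        (BettiUniverse.pullEquiv (fiberIsoM ℂ n d M t'.1) k).symm) := by
  rw [isRatTransport_familyM_iff n d M k hU hU' γ' γ hγ]
  intro v
  rw [← hT v]
  congr 1
  simp only [LinearEquiv.trans_apply, LinearEquiv.apply_symm_apply]

/-- **The monodromy group can only shrink under the base change** (elementwise): the conjugate of a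
monodromy transformation `g ∈ Γ_{M,t}` of the `M`-supported family by the fibre isomorphism `e_t` is a
monodromy transformation of the universal family at `g_M(t)`.
[cite: CarlsonMullerStachPeters2017, Lemma–Definition 15.3.7] -/
theorem conj_mem_ratMonodromyGroup_family
    (hU : IsCohomologicallyLocallyTrivialOn (family ℂ n d) Set.univ)
    (hU' : IsCohomologicallyLocallyTrivialOn (familyM ℂ n d M) Set.univ)
    (t' : (Set.univ : Set (ComplexPoints (baseM ℂ n d M))))
    {g : bettiCohomology (fiberOver (familyM ℂ n d M) t'.1) k ≃ₗ[ℚ]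
      bettiCohomology (fiberOver (familyM ℂ n d M) t'.1) k}
    (hg : g ∈ ratMonodromyGroup (familyM ℂ n d M) k hU' t') :
    (BettiUniverse.pullEquiv (fiberIsoM ℂ n d M t'.1) k).symm ≪≫ₗ g ≪≫ₗ
        BettiUniverse.pullEquiv (fiberIsoM ℂ n d M t'.1) k ∈
      ratMonodromyGroup (family ℂ n d) k hU ⟨AlgPoints.map (toBase ℂ n d M) t'.1, Set.mem_univ _⟩ := by
  obtain ⟨δ, hδ⟩ := hg
  induction δ using Quotient.inductionOn with
  | h γ' =>
    exact ⟨⟦γ'.map (continuous_mapToBaseUniv n d M)⟧,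
      (isRatTransport_familyM_iff n d M k hU hU' γ' (γ'.map (continuous_mapToBaseUniv n d M)) (fun _ => rfl) g).1
        hδ⟩

/-- Conversely, **a monodromy transformation of the universal family along a loop that lifts to `S_M(ℂ)`
restricts to the `M`-supported family**: if `T ∈ GL(Hᵏ(𝒴_{g t}; ℚ))` is the rational transport along the
image `γ` of a loop `γ'` at `t` in `S_M(ℂ)`, then `e_t^* ∘ T ∘ (e_t^*)⁻¹ ∈ Γ_{M,t}`.
[cite: CarlsonMullerStachPeters2017, Lemma–Definition 15.3.7] -/
theorem conj_mem_ratMonodromyGroup_familyM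
    (hU : IsCohomologicallyLocallyTrivialOn (family ℂ n d) Set.univ)
    (hU' : IsCohomologicallyLocallyTrivialOn (familyM ℂ n d M) Set.univ)
    {t' : (Set.univ : Set (ComplexPoints (baseM ℂ n d M)))} (γ' : Path t' t')
    (γ : Path (⟨AlgPoints.map (toBase ℂ n d M) t'.1, Set.mem_univ _⟩ :
        (Set.univ : Set (ComplexPoints (base ℂ n d)))) ⟨AlgPoints.map (toBase ℂ n d M) t'.1, Set.mem_univ _⟩)
    (hγ : ∀ u, AlgPoints.map (toBase ℂ n d M) (γ' u).1 = (γ u).1)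
    {T : bettiCohomology (fiberOver (family ℂ n d) (AlgPoints.map (toBase ℂ n d M) t'.1)) k ≃ₗ[ℚ]
      bettiCohomology (fiberOver (family ℂ n d) (AlgPoints.map (toBase ℂ n d M) t'.1)) k}
    (hT : IsRatTransport (family ℂ n d) k hU ⟦γ⟧ T) :
    BettiUniverse.pullEquiv (fiberIsoM ℂ n d M t'.1) k ≪≫ₗ T ≪≫ₗ
        (BettiUniverse.pullEquiv (fiberIsoM ℂ n d M t'.1) k).symm ∈
      ratMonodromyGroup (familyM ℂ n d M) k hU' t' :=
  ⟨⟦γ'⟧, isRatTransport_familyM_of_family n d M k hU hU' γ' γ hγ hT⟩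

end BaseChange

end Literature.AlgebraicGeometry.HodgeTheory.UniversalHypersurface

end
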